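import Mathlib
import HarnessLib
import Literature.Computability.QuantumComplexity.AaronsonAmbainis

/-!
# The `L¹` form of the Aaronson–Ambainis conjecture is equivalent to the `L²` form
# (Aaronson–Ambainis 2014, Proposition 6.2)

REPRODUCTION, with proof, of: S. Aaronson, A. Ambainis, *The need for structure in quantum
speedups*, Theory of Computing 10 (2014) 133–166, Proposition 6.2 (p. 160): the `L¹` form of the
influence conjecture — Conjecture 6.1 there, which is Conjecture 6 VERBATIM of the arXiv versions
arXiv:0911.0996 (p. 6: "Suppose that `0 ≤ p(X) ≤ 1` for all `X ∈ {0,1}^N`, and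
`E_{X,Y}[|p(X) − p(Y)|] ≥ ε`. Then there exists an `i` such that `Inf_i[p] ≥ (ε/d)^{O(1)}`", with
`Inf_i[p] := E_X[|p(X) − p(X^i)|]`) — is equivalent to the `L²`/variance form, Conjecture 1.7 of the
journal version, which the tree records as `AAConjecture` (`AaronsonAmbainis.lean`).

What is proved here (`AAConjecture_iff_l1Form`):

  `AAConjecture ↔ ∃ c C > 0, ∀ N d p ε, 1 ≤ d → deg p ≤ d → (0 ≤ p ≤ 1 on {0,1}^N) → 0 < ε →`
  `   ε ≤ E_{X,Y}|p(X) − p(Y)| → ∃ i, C·(ε/d)^c ≤ E_X|p(X) − p(X^i)|`,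

the right-hand side being the arXiv Conjecture 6 with its `(ε/d)^{O(1)}` rendered, exactly as in
`AAConjecture`, by universal constants `c ∈ ℕ`, `C > 0`.  The proof is the two Jensen /
boundedness lines of the source: for `[0,1]`-valued `p`,
`E_{X,Y}(p(X) − p(Y))² = 2·Var p` (`avg_avg_sq_sub_eq`), `(E|h|)² ≤ E h² ≤ E|h|` whenever `|h| ≤ 1`
(`sq_boolAvg_le`, `boolAvg_sq_le_abs`); hence `ε ≤ E|p(X)−p(Y)| ⟹ Var p ≥ ε²/2` and
`Inf^{L²} ≤ Inf^{L¹} ≤ (Inf^{L²})^{1/2}`, so the constants transform as `(c, C) ↦ (2c, C/2^c)` in one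
direction and `(c, C) ↦ (2c, C²)` in the other.  No definitions are introduced (the `L¹` form is
displayed inline, so that `AAConjecture` keeps its single name in the tree); trust base Mathlib.

Filed by the solo seat `solo-QuantumAdvantage-informed` (session 17) to remove the last prose step
from its PROPOSITION C: together with `Summits/QuantumAdvantage/QuantumAdvantage/Theorems/
SoloInformedSimulationIffAA.lean` (`AAConjecture ↔` polynomial-depth classical simulation of bounded
polynomials) this identifies the arXiv Conjecture 6 itself with `poly(d, 1/ε, 1/δ)` simulability.

## References
* S. Aaronson, A. Ambainis, *The need for structure in quantum speedups*, Theory of Computing 10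
  (2014) 133–166, Conj. 1.7, Conj. 6.1, Prop. 6.2; arXiv:0911.0996, Conjecture 6 (p. 6)
  [AaronsonAmbainis2014].
-/

noncomputable section

namespace Literature.Computability.QuantumComplexity

namespace AaronsonAmbainisL1

open Finset

variable {N : ℕ}

/-- Monotonicity of the uniform average. [folklore] -/
theorem boolAvg_mono {f g : (Fin N → Bool) → ℝ} (h : ∀ x, f x ≤ g x) : boolAvg f ≤ boolAvg g := by
  unfold boolAvg
  gcongr with x _
  exact h x

/-- An average of quantities `≤ 1` is `≤ 1`. [folklore] -/
theorem boolAvg_le_one {f : (Fin N → Bool) → ℝ} (h : ∀ x, f x ≤ 1) : boolAvg f ≤ 1 :=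
  (boolAvg_mono h).trans_eq (boolAvg_const 1)

/-- The number of points of the cube, as a real number. [folklore] -/
theorem card_cube_real : ((univ : Finset (Fin N → Bool)).card : ℝ) = (2 : ℝ) ^ N := by
  simp [Finset.card_univ, Fintype.card_bool, Fintype.card_fin]

/-- Jensen / Cauchy–Schwarz: `(E h)² ≤ E h²`. [folklore] -/
theorem sq_boolAvg_le (h : (Fin N → Bool) → ℝ) : (boolAvg h) ^ 2 ≤ boolAvg fun x => h x ^ 2 := by
  unfold boolAvg
  have hcs := Finset.sum_mul_sq_le_sq_mul_sq (univ : Finset (Fin N → Bool)) h (fun _ => (1 : ℝ))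
  simp only [mul_one, one_pow, sum_const, nsmul_eq_mul, card_cube_real] at hcs
  have h2 : (0 : ℝ) < 2 ^ N := by positivity
  rw [div_pow, div_le_div_iff₀ (by positivity) h2]
  calc (∑ x, h x) ^ 2 * 2 ^ N ≤ ((∑ x, h x ^ 2) * 2 ^ N) * 2 ^ N :=
        mul_le_mul_of_nonneg_right (by linarith) h2.le
    _ = (∑ x, h x ^ 2) * (2 ^ N) ^ 2 := by ring

/-- For `|h| ≤ 1`: `E h² ≤ E|h|`. [folklore] -/
theorem boolAvg_sq_le_abs (h : (Fin N → Bool) → ℝ) (hb : ∀ x, |h x| ≤ 1) :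
    (boolAvg fun x => h x ^ 2) ≤ boolAvg fun x => |h x| :=
  boolAvg_mono fun x => by
    rw [← sq_abs]
    nlinarith [abs_nonneg (h x), hb x]

/-- `E_{X,Y}(p(X) − p(Y))² = 2·Var[p]`. [folklore] -/
theorem avg_avg_sq_sub_eq (p : MvPolynomial (Fin N) ℝ) :
    (boolAvg fun x => boolAvg fun y => (evalBool p x - evalBool p y) ^ 2) = 2 * boolVariance p := by
  unfold boolVariance boolAvg
  generalize hm : (∑ x, evalBool p x) / (2 : ℝ) ^ N = m
  have h2 : (2 : ℝ) ^ N ≠ 0 := by positivity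
  have hsum0 : ∑ y, (evalBool p y - m) = 0 := by
    rw [Finset.sum_sub_distrib, Finset.sum_const, nsmul_eq_mul, card_cube_real, ← hm]
    have e : (2 : ℝ) ^ N * ((∑ x, evalBool p x) / 2 ^ N) = ∑ x, evalBool p x := by field_simp
    rw [e, sub_self]
  have hy : ∀ x, ∑ y, (evalBool p x - evalBool p y) ^ 2
      = (2 : ℝ) ^ N * (evalBool p x - m) ^ 2 + ∑ y, (evalBool p y - m) ^ 2 := by
    intro x
    have e : ∀ y, (evalBool p x - evalBool p y) ^ 2 = (evalBool p x - m) ^ 2 +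
        ((evalBool p y - m) ^ 2 - 2 * (evalBool p x - m) * (evalBool p y - m)) := fun y => by ring
    simp_rw [e]
    rw [Finset.sum_add_distrib, Finset.sum_sub_distrib, Finset.sum_const, nsmul_eq_mul,
      card_cube_real, ← Finset.mul_sum, hsum0, mul_zero, sub_zero]
  simp_rw [hy]
  have hx : ∑ x, ((2 : ℝ) ^ N * (evalBool p x - m) ^ 2 + ∑ y, (evalBool p y - m) ^ 2) / 2 ^ N
      = 2 * ∑ y, (evalBool p y - m) ^ 2 := by
    rw [← Finset.sum_div, Finset.sum_add_distrib, Finset.sum_const, nsmul_eq_mul, card_cube_real,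
      ← Finset.mul_sum]
    field_simp
    ring
  rw [hx]
  ring

/-- For `[0,1]`-valued `p`, differences of values are bounded by `1`. [folklore] -/
theorem abs_sub_le_one {p : MvPolynomial (Fin N) ℝ} (hbd : ∀ x, 0 ≤ evalBool p x ∧ evalBool p x ≤ 1)
    (x y : Fin N → Bool) : |evalBool p x - evalBool p y| ≤ 1 :=
  abs_sub_le_iff.2 ⟨by linarith [(hbd x).2, (hbd y).1], by linarith [(hbd y).2, (hbd x).1]⟩

/-- `2·Var[p] ≤ E_{X,Y}|p(X) − p(Y)|` for `[0,1]`-valued `p`. [folklore] -/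
theorem two_mul_boolVariance_le_avg_abs {p : MvPolynomial (Fin N) ℝ}
    (hbd : ∀ x, 0 ≤ evalBool p x ∧ evalBool p x ≤ 1) :
    2 * boolVariance p ≤ boolAvg fun x => boolAvg fun y => |evalBool p x - evalBool p y| := by
  rw [← avg_avg_sq_sub_eq]
  exact boolAvg_mono fun x => boolAvg_sq_le_abs _ fun y => abs_sub_le_one hbd x y

/-- `(E_{X,Y}|p(X) − p(Y)|)² ≤ 2·Var[p]`. [folklore] -/
theorem sq_avg_abs_le_two_mul_boolVariance (p : MvPolynomial (Fin N) ℝ) :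
    (boolAvg fun x => boolAvg fun y => |evalBool p x - evalBool p y|) ^ 2 ≤ 2 * boolVariance p := by
  rw [← avg_avg_sq_sub_eq]
  calc (boolAvg fun x => boolAvg fun y => |evalBool p x - evalBool p y|) ^ 2
      ≤ boolAvg fun x => (boolAvg fun y => |evalBool p x - evalBool p y|) ^ 2 := sq_boolAvg_le _
    _ ≤ boolAvg fun x => boolAvg fun y => (evalBool p x - evalBool p y) ^ 2 :=
        boolAvg_mono fun x => (sq_boolAvg_le _).trans_eq (by simp_rw [sq_abs])

/-- `Inf^{L²}_i[p] ≤ Inf^{L¹}_i[p]` for `[0,1]`-valued `p`. [folklore] -/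
theorem influence_le_l1 {p : MvPolynomial (Fin N) ℝ}
    (hbd : ∀ x, 0 ≤ evalBool p x ∧ evalBool p x ≤ 1) (i : Fin N) :
    influence i p ≤ boolAvg fun x => |evalBool p x - evalBool p (flipBit i x)| :=
  boolAvg_sq_le_abs _ fun x => abs_sub_le_one hbd x (flipBit i x)

/-- `(Inf^{L¹}_i[p])² ≤ Inf^{L²}_i[p]`. [folklore] -/
theorem sq_l1_le_influence (p : MvPolynomial (Fin N) ℝ) (i : Fin N) :
    (boolAvg fun x => |evalBool p x - evalBool p (flipBit i x)|) ^ 2 ≤ influence i p :=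
  (sq_boolAvg_le _).trans_eq (by unfold influence; simp_rw [sq_abs])

end AaronsonAmbainisL1

open AaronsonAmbainisL1 in
/-- **Aaronson–Ambainis 2014, Proposition 6.2** (the `L¹` and `L²` forms of the influence
conjecture are equivalent): the tree's `AAConjecture` (ToC Conj. 1.7, hypothesis `Var[p] ≥ ε`,
conclusion on `E_X(p(X) − p(X^i))²`) holds iff the arXiv Conjecture 6 / ToC Conjecture 6.1 does
(hypothesis `E_{X,Y}|p(X) − p(Y)| ≥ ε`, conclusion on `E_X|p(X) − p(X^i)|`), each with universal
constants `c ∈ ℕ`, `C > 0` for the printed `(ε/d)^{O(1)}`. Constants: `(c, C) ↦ (2c, C/2^c)`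
forwards, `(c, C) ↦ (2c, C²)` backwards.
[cite: AaronsonAmbainis2014, Prop. 6.2 (ToC 10 p. 160); arXiv:0911.0996 Conjecture 6 (p. 6)] -/
theorem AAConjecture_iff_l1Form :
    AAConjecture ↔
      ∃ (c : ℕ) (C : ℝ), 0 < C ∧ ∀ (N d : ℕ) (p : MvPolynomial (Fin N) ℝ) (ε : ℝ), 1 ≤ d →
        p.totalDegree ≤ d → (∀ x, 0 ≤ evalBool p x ∧ evalBool p x ≤ 1) → 0 < ε →
          ε ≤ (boolAvg fun x => boolAvg fun y => |evalBool p x - evalBool p y|) →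
            ∃ i : Fin N, C * (ε / d) ^ c ≤ boolAvg fun x => |evalBool p x - evalBool p (flipBit i x)| := by
  constructor
  · rintro ⟨c, C, hC, H⟩
    refine ⟨2 * c, C / 2 ^ c, by positivity, ?_⟩
    intro N d p ε hd hdeg hbd hε hA
    have hd1 : (1 : ℝ) ≤ d := by exact_mod_cast hd
    -- Var p ≥ ε²/2
    have hV : ε ^ 2 / 2 ≤ boolVariance p := by
      have h1 : ε ^ 2 ≤ (boolAvg fun x => boolAvg fun y => |evalBool p x - evalBool p y|) ^ 2 :=
        pow_le_pow_left₀ hε.le hA 2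
      linarith [sq_avg_abs_le_two_mul_boolVariance p]
    obtain ⟨i, hi⟩ := H N d p (ε ^ 2 / 2) hd hdeg hbd (by positivity) hV
    refine ⟨i, ?_⟩
    have hbase : (ε / d) ^ 2 / 2 ≤ ε ^ 2 / 2 / d := by
      have hd0 : (0 : ℝ) < d := by linarith
      rw [div_pow, div_div, div_div, div_le_div_iff₀ (by positivity) (by positivity)]
      have : ε ^ 2 * (2 * (d : ℝ)) * 1 ≤ ε ^ 2 * (2 * d) * d :=
        mul_le_mul_of_nonneg_left hd1 (by positivity)
      nlinarith [this]
    calc C / 2 ^ c * (ε / d) ^ (2 * c) = C * (((ε / d) ^ 2) ^ c / 2 ^ c) := by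
          rw [← pow_mul]; ring
      _ = C * ((ε / d) ^ 2 / 2) ^ c := by rw [div_pow ((ε / d) ^ 2) 2 c]
      _ ≤ C * (ε ^ 2 / 2 / d) ^ c := by
          gcongr
      _ ≤ influence i p := hi
      _ ≤ _ := influence_le_l1 hbd i
  · rintro ⟨c, C, hC, H⟩
    refine ⟨2 * c, C ^ 2, by positivity, ?_⟩
    intro N d p ε hd hdeg hbd hε hεV
    have hA : ε ≤ boolAvg fun x => boolAvg fun y => |evalBool p x - evalBool p y| := by
      linarith [two_mul_boolVariance_le_avg_abs hbd, boolVariance_nonneg p]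
    obtain ⟨i, hi⟩ := H N d p ε hd hdeg hbd hε hA
    refine ⟨i, ?_⟩
    have h0 : 0 ≤ C * (ε / d) ^ c := by positivity
    calc C ^ 2 * (ε / d) ^ (2 * c) = (C * (ε / d) ^ c) ^ 2 := by rw [pow_mul]; ring
      _ ≤ (boolAvg fun x => |evalBool p x - evalBool p (flipBit i x)|) ^ 2 :=
          pow_le_pow_left₀ h0 hi 2
      _ ≤ influence i p := sq_l1_le_influence p i

end Literature.Computability.QuantumComplexity
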